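import Mathlib
import Summits.MatrixMultiplication.MatrixMultiplication.Theorems.SnSubsetDichotomyHyperoctahedralThresholdStubSameColourSupply

/-!
# Same-colour reflection supply restricted to GOOD darts, and the counted forbidden-set form
# (crux `HyperoctahedralThreshold`, refutation line, open core `stub_poorRigidCore`; siege k9, variation supply/tip)

Conventions of the sibling file `…StubSameColourSupply` (lead c3, p112303): three involutions `μ b` of `Fin n` act on the
right, `x · g := g.foldl (fun v b => μ b v) x`; a DART of colour `c` and length `k` is a pair `(a, g)` with `g` reduced of
length `k` and first letter `≠ c`; its image is the ordered pair `(a · g, (μ c a) · g)`; a SAME-COLOUR REFLECTION STRUCTURE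
of colour `c` and length `m` is `(a, g')`, `g'` reduced of length `m` with first and last letter `≠ c`, such that
`μ c (a · g') = (μ c a) · g'`.

What is new here (the "supply" half of the supply/tip dichotomy WITH A FORBIDDEN SET, crux NOTES §15.1 + §C4):

* `sameColourSupply_restricted` — the supply inequality for an ARBITRARY set `G` of darts:
  `|G|² ≤ (n² - n) · (|G| + Σ_{i<k} #{(s, (a, g')) : |s| = i, (a, g') a structure of length 2k - 2i, and BOTH darts
  reconstructed from it — `(a, g'.take (k-i) ++ s)` and `(a · g', (g'.drop (k-i))⁻¹ ++ s)` — lie in G})`.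
  (Cauchy–Schwarz over the `n² - n` off-diagonal cells exactly as in the sibling file, but keeping track of which darts the
  colliding pair consisted of.)  This is the entry point of every DART-LEVEL bookkeeping: restrictions that are cheap on darts
  (`R`-avoidance, self-cleanness, avoidance of dense spots — all of density `o(1)` among the `n · 2^k` darts) are inherited
  by the structures position by position, whereas the same restrictions imposed directly on structures (density `≈ 1/n` at the
  top scale) are not affordable (crux NOTES §C4).
* `card_darts_hitting_le` — the bijection trick: for every time `t` and every set `S`, at most `|S| · 2^k` darts have their
  `t`-th trajectory point (on either side) in `S`.
* `structure_avoids_of_darts_avoid` — position-by-position inheritance: if both reconstructed darts avoid `S` along their whole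
  trajectories, the structure avoids `S` at all of its `2(m+1)` points.
* `sameColourSupplyAvoiding` / `stub_sameColourSupplyAvoiding` — the counted forbidden-set supply:
  `(n·2^k - 2(k+1)|S|·2^k)² ≤ (n² - n) · (n·2^k + Σ_{i<k} 3^i · Π^S(2k - 2i))`, where `Π^S(m)` counts the structures of
  length `m` ALL of whose trajectory points `a · g'_[t]`, `(μ c a) · g'_[t]` (`t ≤ m`) avoid `S`.  For `S = ∅` this is the
  sibling's `stub_sameColourSupply`; for `S = R` (`|R| ≤ n^{3/4}`) and `2^k ≥ 4n` it yields `≥ n²` colliding pairs of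
  `R`-free darts, i.e. a counted supply of `R`-free structures at some scale `m ≤ 2k` — the quantity the open core needs,
  with no hypothesis on the host.

Pure finite combinatorics under `import Mathlib` + the sibling supply file (whose `collision_structure`, `collision_inverse`,
`card_sq_le_card_mul_card_pairs`, `card_redWords`, `card_words`, `exists_step` are reused); no definitions are introduced.
-/

set_option linter.dupNamespace false

namespace Summit.MatrixMultiplication.MatrixMultiplication.Theorems.HyperoctahedralThreshold.SupplyAvoiding

open Finset
open Summit.MatrixMultiplication.MatrixMultiplication.Theorems.HyperoctahedralThreshold.Supply

variable {n : ℕ}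

/-! ### Collisions inside a set of darts -/

/-- Collisions INSIDE a set `G` of darts whose longest common suffix has length exactly `i < k` inject into the pairs
`(s, (a, g'))` — suffix of length `i`, same-colour structure of length `2k - 2i` — whose two reconstructed darts
`(a, g'.take (k-i) ++ s)` and `(a · g', (g'.drop (k-i)).reverse ++ s)` both lie in `G`. -/
theorem card_collisions_le_restricted (μ : Fin 3 → Equiv.Perm (Fin n)) (hμ : ∀ b, μ b * μ b = 1) (c : Fin 3)
    (k i : ℕ) (hi : i < k) (G : Finset (Fin n × List (Fin 3)))
    (hG : G ⊆ (Finset.univ : Finset (Fin n)) ×ˢ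
        (((Finset.univ : Finset (List.Vector (Fin 3) k)).image (fun v => v.toList)).filter
          (fun g => List.IsChain (· ≠ ·) g ∧ g.head? ≠ some c))) :
    (((G ×ˢ G).filter
      (fun q => q.1 ≠ q.2 ∧
        q.1.2.foldl (fun v b => μ b v) q.1.1 = q.2.2.foldl (fun v b => μ b v) q.2.1 ∧
        q.1.2.foldl (fun v b => μ b v) (μ c q.1.1) = q.2.2.foldl (fun v b => μ b v) (μ c q.2.1))).filter
      (fun q => q.1.2.drop (k - i) = q.2.2.drop (k - i) ∧
        q.1.2.drop (k - (i + 1)) ≠ q.2.2.drop (k - (i + 1)))).card ≤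
    ((((Finset.univ : Finset (List.Vector (Fin 3) i)).image (fun v => v.toList)) ×ˢ
      (((Finset.univ : Finset (Fin n)) ×ˢ
        (((Finset.univ : Finset (List.Vector (Fin 3) (2 * k - 2 * i))).image (fun v => v.toList)).filter
          (fun g => List.IsChain (· ≠ ·) g ∧ g.head? ≠ some c ∧ g.getLast? ≠ some c))).filter
        (fun p => μ c (p.2.foldl (fun v b => μ b v) p.1) = p.2.foldl (fun v b => μ b v) (μ c p.1)))).filter
      (fun r => (r.2.1, r.2.2.take (k - i) ++ r.1) ∈ G ∧
        (r.2.2.foldl (fun v b => μ b v) r.2.1, (r.2.2.drop (k - i)).reverse ++ r.1) ∈ G)).card := by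
  refine Finset.card_le_card_of_injOn
    (fun q => (q.1.2.drop (k - i), (q.1.1, q.1.2.take (k - i) ++ (q.2.2.take (k - i)).reverse))) ?_ ?_
  · intro q hq
    rw [Finset.mem_coe, Finset.mem_filter, Finset.mem_filter, Finset.mem_product] at hq
    obtain ⟨⟨⟨hq₁, hq₂⟩, -, he₁, he₂⟩, hs, hns⟩ := hq
    have hg₁ := (Finset.mem_product.1 (hG hq₁)).2
    have hg₂ := (Finset.mem_product.1 (hG hq₂)).2
    rw [Finset.mem_filter, mem_words] at hg₁ hg₂
    obtain ⟨hl₁, hc₁, hh₁⟩ := hg₁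
    obtain ⟨hl₂, hc₂, hh₂⟩ := hg₂
    obtain ⟨H1, H2, H3, H4, H5, H6⟩ :=
      collision_structure μ hμ c hi hl₁ hl₂ hc₁ hc₂ hh₁ hh₂ he₁ he₂ hs hns
    obtain ⟨E1, E2⟩ := collision_inverse hi.le hl₁ hl₂ hs
    rw [Finset.mem_coe, Finset.mem_filter, Finset.mem_product]
    refine ⟨⟨mem_words.2 (by rw [List.length_drop, hl₁]; omega), ?_⟩, ?_⟩
    · rw [Finset.mem_filter, Finset.mem_product, Finset.mem_filter, mem_words]
      refine ⟨⟨Finset.mem_univ _, H1, H2, H3, H4⟩, ?_⟩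
      dsimp only
      rw [H5, H6]
    · dsimp only
      rw [E1, H5, E2]
      exact ⟨hq₁, hq₂⟩
  · refine Set.LeftInvOn.injOn (f₁' := fun r => ((r.2.1, r.2.2.take (k - i) ++ r.1),
      (r.2.2.foldl (fun v b => μ b v) r.2.1, (r.2.2.drop (k - i)).reverse ++ r.1))) ?_
    intro q hq
    rw [Finset.mem_coe, Finset.mem_filter, Finset.mem_filter, Finset.mem_product] at hq
    obtain ⟨⟨⟨hq₁, hq₂⟩, -, he₁, he₂⟩, hs, hns⟩ := hq
    have hg₁ := (Finset.mem_product.1 (hG hq₁)).2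
    have hg₂ := (Finset.mem_product.1 (hG hq₂)).2
    rw [Finset.mem_filter, mem_words] at hg₁ hg₂
    obtain ⟨hl₁, hc₁, hh₁⟩ := hg₁
    obtain ⟨hl₂, hc₂, hh₂⟩ := hg₂
    obtain ⟨-, -, -, -, H5, -⟩ :=
      collision_structure μ hμ c hi hl₁ hl₂ hc₁ hc₂ hh₁ hh₂ he₁ he₂ hs hns
    obtain ⟨E1, E2⟩ := collision_inverse hi.le hl₁ hl₂ hs
    dsimp only
    rw [E1, E2, H5]

/-- **Restricted supply.**  For ANY set `G` of darts of colour `c` and length `k`: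
`|G|² ≤ (n² - n) · (|G| + Σ_{i<k} #{(s, (a, g')) : both reconstructed darts in G})` (notation of
`card_collisions_le_restricted`).  Cauchy–Schwarz over the `n² - n` off-diagonal cells, as in the sibling
`sameColourSupply`, which is the case `G = all darts` after forgetting the membership conditions. -/
theorem sameColourSupply_restricted (n k : ℕ) (μ : Fin 3 → Equiv.Perm (Fin n)) (c : Fin 3)
    (hμ : ∀ b, μ b * μ b = 1) (hfix : ∀ b v, μ b v ≠ v) (G : Finset (Fin n × List (Fin 3)))
    (hG : G ⊆ (Finset.univ : Finset (Fin n)) ×ˢ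
        (((Finset.univ : Finset (List.Vector (Fin 3) k)).image (fun v => v.toList)).filter
          (fun g => List.IsChain (· ≠ ·) g ∧ g.head? ≠ some c))) :
    G.card ^ 2 ≤ (n * n - n) * (G.card + ∑ i ∈ Finset.range k,
      ((((Finset.univ : Finset (List.Vector (Fin 3) i)).image (fun v => v.toList)) ×ˢ
        (((Finset.univ : Finset (Fin n)) ×ˢ
          (((Finset.univ : Finset (List.Vector (Fin 3) (2 * k - 2 * i))).image (fun v => v.toList)).filter
            (fun g => List.IsChain (· ≠ ·) g ∧ g.head? ≠ some c ∧ g.getLast? ≠ some c))).filter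
          (fun p => μ c (p.2.foldl (fun v b => μ b v) p.1) = p.2.foldl (fun v b => μ b v) (μ c p.1)))).filter
        (fun r => (r.2.1, r.2.2.take (k - i) ++ r.1) ∈ G ∧
          (r.2.2.foldl (fun v b => μ b v) r.2.1, (r.2.2.drop (k - i)).reverse ++ r.1) ∈ G)).card) := by
  -- the endpoint map `Φ (a, g) = (a·g, (c a)·g)` lands off the diagonal
  set Φ : Fin n × List (Fin 3) → Fin n × Fin n :=
    fun p => (p.2.foldl (fun v b => μ b v) p.1, p.2.foldl (fun v b => μ b v) (μ c p.1)) with hΦ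
  have hmaps : ∀ p ∈ G, Φ p ∈ (Finset.univ : Finset (Fin n)).offDiag := by
    intro p _
    rw [Finset.mem_offDiag]
    refine ⟨Finset.mem_univ _, Finset.mem_univ _, ?_⟩
    intro h
    exact hfix c p.1 (foldl_act_injective μ hμ p.2 h).symm
  have hCS := card_sq_le_card_mul_card_pairs G (Finset.univ : Finset (Fin n)).offDiag Φ hmaps
  rw [Finset.offDiag_card, Finset.card_univ, Fintype.card_fin] at hCS
  refine hCS.trans (Nat.mul_le_mul_left _ ?_)
  -- pairs with equal endpoints are diagonal or collisions
  set C := (G ×ˢ G).filter (fun q => q.1 ≠ q.2 ∧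
    q.1.2.foldl (fun v b => μ b v) q.1.1 = q.2.2.foldl (fun v b => μ b v) q.2.1 ∧
    q.1.2.foldl (fun v b => μ b v) (μ c q.1.1) = q.2.2.foldl (fun v b => μ b v) (μ c q.2.1)) with hC
  have hF : (G ×ˢ G).filter (fun q => Φ q.1 = Φ q.2) ⊆ G.diag ∪ C := by
    intro q hq
    rw [Finset.mem_filter] at hq
    rw [Finset.mem_union, Finset.mem_diag]
    by_cases h : q.1 = q.2
    · exact Or.inl ⟨(Finset.mem_product.1 hq.1).1, h⟩
    · exact Or.inr (Finset.mem_filter.2 ⟨hq.1, h, congrArg Prod.fst hq.2, congrArg Prod.snd hq.2⟩)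
  have hFcard : ((G ×ˢ G).filter (fun q => Φ q.1 = Φ q.2)).card ≤ G.card + C.card := by
    refine (Finset.card_le_card hF).trans ((Finset.card_union_le _ _).trans ?_)
    rw [Finset.diag_card]
  refine hFcard.trans (Nat.add_le_add_left ?_ _)
  -- collisions, sorted by the length `i < k` of the longest common suffix
  have hcover : C ⊆ (Finset.range k).biUnion (fun i => C.filter (fun q =>
      q.1.2.drop (k - i) = q.2.2.drop (k - i) ∧ q.1.2.drop (k - (i + 1)) ≠ q.2.2.drop (k - (i + 1)))) := by
    intro q hq
    have hq' := hq
    rw [hC, Finset.mem_filter, Finset.mem_product] at hq'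
    obtain ⟨⟨hq₁, hq₂⟩, hne, he₁, -⟩ := hq'
    have hg₁ := (Finset.mem_product.1 (hG hq₁)).2
    have hg₂ := (Finset.mem_product.1 (hG hq₂)).2
    rw [Finset.mem_filter, mem_words] at hg₁ hg₂
    obtain ⟨i, hik, hPi, hnP⟩ := exists_step (P := fun j => q.1.2.drop (k - j) = q.2.2.drop (k - j)) k
      (by
        rw [Nat.sub_zero, List.drop_of_length_le (by rw [hg₁.1]), List.drop_of_length_le (by rw [hg₂.1])])
      (by
        rw [Nat.sub_self, List.drop_zero, List.drop_zero]
        intro hg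
        apply hne
        have he := he₁
        rw [hg] at he
        exact Prod.ext (foldl_act_injective μ hμ q.2.2 he) hg)
    exact Finset.mem_biUnion.2 ⟨i, Finset.mem_range.2 hik, Finset.mem_filter.2 ⟨hq, hPi, hnP⟩⟩
  refine (Finset.card_le_card hcover).trans (Finset.card_biUnion_le.trans ?_)
  refine Finset.sum_le_sum (fun i hi => ?_)
  exact card_collisions_le_restricted μ hμ c k i (Finset.mem_range.1 hi) G hG

/-! ### The bijection trick: darts through a set are few -/

/-- For a fixed time `t`, the darts `(a, g)` whose `t`-th trajectory point `a · g_[t]` lies in `S` number at most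
`|S| · 2^k`: the map `(a, g) ↦ (a · g_[t], g)` is injective (words act by permutations). -/
theorem card_darts_hitting_le (μ : Fin 3 → Equiv.Perm (Fin n)) (hμ : ∀ b, μ b * μ b = 1) (c : Fin 3)
    (k t : ℕ) (S : Finset (Fin n)) :
    (((Finset.univ : Finset (Fin n)) ×ˢ
        (((Finset.univ : Finset (List.Vector (Fin 3) k)).image (fun v => v.toList)).filter
          (fun g => List.IsChain (· ≠ ·) g ∧ g.head? ≠ some c))).filter
      (fun p => (p.2.take t).foldl (fun v b => μ b v) p.1 ∈ S)).card ≤ S.card * 2 ^ k := by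
  rw [← card_redWords k c, ← Finset.card_product]
  refine Finset.card_le_card_of_injOn (fun p => ((p.2.take t).foldl (fun v b => μ b v) p.1, p.2)) ?_ ?_
  · intro p hp
    rw [Finset.mem_coe, Finset.mem_filter, Finset.mem_product] at hp
    rw [Finset.mem_coe, Finset.mem_product]
    exact ⟨hp.2, hp.1.2⟩
  · intro p _ q _ hpq
    simp only [Prod.mk.injEq] at hpq
    obtain ⟨h1, h2⟩ := hpq
    refine Prod.ext ?_ h2
    rw [h2] at h1
    exact foldl_act_injective μ hμ _ h1

/-- The same count for the `c`-side trajectory `(μ c a) · g_[t]`. -/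
theorem card_darts_hitting_le' (μ : Fin 3 → Equiv.Perm (Fin n)) (hμ : ∀ b, μ b * μ b = 1) (c : Fin 3)
    (k t : ℕ) (S : Finset (Fin n)) :
    (((Finset.univ : Finset (Fin n)) ×ˢ
        (((Finset.univ : Finset (List.Vector (Fin 3) k)).image (fun v => v.toList)).filter
          (fun g => List.IsChain (· ≠ ·) g ∧ g.head? ≠ some c))).filter
      (fun p => (p.2.take t).foldl (fun v b => μ b v) (μ c p.1) ∈ S)).card ≤ S.card * 2 ^ k := by
  rw [← card_redWords k c, ← Finset.card_product]
  refine Finset.card_le_card_of_injOn (fun p => ((p.2.take t).foldl (fun v b => μ b v) (μ c p.1), p.2)) ?_ ?_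
  · intro p hp
    rw [Finset.mem_coe, Finset.mem_filter, Finset.mem_product] at hp
    rw [Finset.mem_coe, Finset.mem_product]
    exact ⟨hp.2, hp.1.2⟩
  · intro p _ q _ hpq
    simp only [Prod.mk.injEq] at hpq
    obtain ⟨h1, h2⟩ := hpq
    refine Prod.ext ?_ h2
    rw [h2] at h1
    have h3 := foldl_act_injective μ hμ _ h1
    exact (μ c).injective h3

/-- Hence the darts that avoid `S` at every time `t ≤ k` on both sides number at least `n · 2^k - 2(k+1) · |S| · 2^k`. -/
theorem card_darts_avoiding_ge (μ : Fin 3 → Equiv.Perm (Fin n)) (hμ : ∀ b, μ b * μ b = 1) (c : Fin 3)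
    (k : ℕ) (S : Finset (Fin n)) :
    n * 2 ^ k ≤ (((Finset.univ : Finset (Fin n)) ×ˢ
        (((Finset.univ : Finset (List.Vector (Fin 3) k)).image (fun v => v.toList)).filter
          (fun g => List.IsChain (· ≠ ·) g ∧ g.head? ≠ some c))).filter
      (fun p : Fin n × List (Fin 3) => ∀ t ∈ Finset.range (k + 1), (p.2.take t).foldl (fun v b => μ b v) p.1 ∉ S ∧
        (p.2.take t).foldl (fun v b => μ b v) (μ c p.1) ∉ S)).card + 2 * (k + 1) * S.card * 2 ^ k := by
  set D := (Finset.univ : Finset (Fin n)) ×ˢ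
    (((Finset.univ : Finset (List.Vector (Fin 3) k)).image (fun v => v.toList)).filter
      (fun g => List.IsChain (· ≠ ·) g ∧ g.head? ≠ some c)) with hD
  have hDcard : D.card = n * 2 ^ k := by
    rw [hD, Finset.card_product, Finset.card_univ, Fintype.card_fin, card_redWords k c]
  have hcover : D ⊆ D.filter (fun p : Fin n × List (Fin 3) => ∀ t ∈ Finset.range (k + 1),
      (p.2.take t).foldl (fun v b => μ b v) p.1 ∉ S ∧ (p.2.take t).foldl (fun v b => μ b v) (μ c p.1) ∉ S) ∪
      (Finset.range (k + 1)).biUnion (fun t =>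
        D.filter (fun p => (p.2.take t).foldl (fun v b => μ b v) p.1 ∈ S) ∪
        D.filter (fun p => (p.2.take t).foldl (fun v b => μ b v) (μ c p.1) ∈ S)) := by
    intro p hp
    rw [Finset.mem_union]
    by_cases h : ∀ t ∈ Finset.range (k + 1),
      (p.2.take t).foldl (fun v b => μ b v) p.1 ∉ S ∧ (p.2.take t).foldl (fun v b => μ b v) (μ c p.1) ∉ S
    · exact Or.inl (Finset.mem_filter.2 ⟨hp, h⟩)
    · right
      push Not at h
      obtain ⟨t, ht, hts⟩ := h
      refine Finset.mem_biUnion.2 ⟨t, ht, ?_⟩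
      rw [Finset.mem_union, Finset.mem_filter, Finset.mem_filter]
      by_cases h1 : (p.2.take t).foldl (fun v b => μ b v) p.1 ∈ S
      · exact Or.inl ⟨hp, h1⟩
      · exact Or.inr ⟨hp, hts h1⟩
  have h := (Finset.card_le_card hcover).trans (Finset.card_union_le _ _)
  rw [hDcard] at h
  refine h.trans (Nat.add_le_add_left ?_ _)
  refine Finset.card_biUnion_le.trans ?_
  have hterm : ∀ t ∈ Finset.range (k + 1),
      (D.filter (fun p => (p.2.take t).foldl (fun v b => μ b v) p.1 ∈ S) ∪
        D.filter (fun p => (p.2.take t).foldl (fun v b => μ b v) (μ c p.1) ∈ S)).card ≤ 2 * S.card * 2 ^ k := by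
    intro t _
    refine (Finset.card_union_le _ _).trans ?_
    have h1 := card_darts_hitting_le μ hμ c k t S
    have h2 := card_darts_hitting_le' μ hμ c k t S
    rw [← hD] at h1 h2
    calc _ ≤ S.card * 2 ^ k + S.card * 2 ^ k := Nat.add_le_add h1 h2
      _ = 2 * S.card * 2 ^ k := by ring
  refine (Finset.sum_le_sum hterm).trans ?_
  rw [Finset.sum_const, Finset.card_range, smul_eq_mul]
  exact le_of_eq (by ring)

/-! ### Position-by-position inheritance -/

/-- Trajectory points of the structure `g' = h₁ ++ h₂ʳ` (`|h₁| = |h₂ʳ| = k - i`) at times `t ≤ k - i` are trajectory points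
of the first dart `h₁ ++ s` at the same time. -/
theorem traj_first_half (μ : Fin 3 → Equiv.Perm (Fin n)) {k i t : ℕ} {g' s : List (Fin 3)}
    (hl : g'.length = 2 * k - 2 * i) (ht : t ≤ k - i) (x : Fin n) :
    (g'.take t).foldl (fun v b => μ b v) x = ((g'.take (k - i) ++ s).take t).foldl (fun v b => μ b v) x := by
  rw [List.take_append_of_le_length (show t ≤ (g'.take (k - i)).length by rw [List.length_take]; omega),
    List.take_take, Nat.min_eq_left ht]

/-- Trajectory points of the structure at times `t = (k - i) + j ≥ k - i` are trajectory points of the SECOND dart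
`(g'.drop (k-i)).reverse ++ s`, started at the far end `x · g'`, at time `k - i - j`. -/
theorem traj_second_half (μ : Fin 3 → Equiv.Perm (Fin n)) (hμ : ∀ b, μ b * μ b = 1) {k i j : ℕ}
    {g' s : List (Fin 3)} (hl : g'.length = 2 * k - 2 * i) (hj : j ≤ k - i) (x : Fin n) :
    (g'.take (k - i + j)).foldl (fun v b => μ b v) x =
      ((((g'.drop (k - i)).reverse ++ s).take (k - i - j)).foldl (fun v b => μ b v)
        (g'.foldl (fun v b => μ b v) x)) := by
  set A := g'.take (k - i) with hA
  set B := g'.drop (k - i) with hB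
  have hg : g' = A ++ B := (List.take_append_drop (k - i) g').symm
  have hlA : A.length = k - i := by rw [hA, List.length_take]; omega
  have hlB : B.length = k - i := by rw [hB, List.length_drop]; omega
  have h1 : g'.take (k - i + j) = A ++ B.take j := by
    rw [hg, List.take_append, List.take_of_length_le (show A.length ≤ k - i + j by omega), hlA,
      show k - i + j - (k - i) = j by omega]
  have h2 : (B.reverse ++ s).take (k - i - j) = (B.drop j).reverse := by
    rw [List.take_append_of_le_length (show k - i - j ≤ B.reverse.length by rw [List.length_reverse]; omega),
      List.take_reverse, hlB, show k - i - (k - i - j) = j by omega]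
  have h3 : g'.foldl (fun v b => μ b v) x =
      (B.drop j).foldl (fun v b => μ b v) ((B.take j).foldl (fun v b => μ b v) (A.foldl (fun v b => μ b v) x)) := by
    rw [← List.foldl_append, List.take_append_drop, ← List.foldl_append, ← hg]
  rw [h1, h2, List.foldl_append, h3, foldl_act_reverse μ hμ]

/-- **Inheritance.**  If both darts reconstructed from `(s, (a, g'))` avoid `S` at all times `≤ k` (on both sides), and
`(a, g')` is a structure (`μ c (a · g') = (μ c a) · g'`), then the structure avoids `S` at all of its `2(m+1)` points,
`m = 2k - 2i`. -/
theorem structure_avoids_of_darts_avoid (μ : Fin 3 → Equiv.Perm (Fin n)) (hμ : ∀ b, μ b * μ b = 1) (c : Fin 3)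
    {k i : ℕ} (hi : i < k) {a : Fin n} {g' s : List (Fin 3)} (S : Finset (Fin n))
    (hl : g'.length = 2 * k - 2 * i)
    (hstr : μ c (g'.foldl (fun v b => μ b v) a) = g'.foldl (fun v b => μ b v) (μ c a))
    (h₁ : ∀ t ∈ Finset.range (k + 1), ((g'.take (k - i) ++ s).take t).foldl (fun v b => μ b v) a ∉ S ∧
      ((g'.take (k - i) ++ s).take t).foldl (fun v b => μ b v) (μ c a) ∉ S)
    (h₂ : ∀ t ∈ Finset.range (k + 1),
      ((((g'.drop (k - i)).reverse ++ s).take t).foldl (fun v b => μ b v) (g'.foldl (fun v b => μ b v) a)) ∉ S ∧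
      ((((g'.drop (k - i)).reverse ++ s).take t).foldl (fun v b => μ b v)
        (μ c (g'.foldl (fun v b => μ b v) a))) ∉ S) :
    ∀ t ∈ Finset.range (2 * k - 2 * i + 1), (g'.take t).foldl (fun v b => μ b v) a ∉ S ∧
      (g'.take t).foldl (fun v b => μ b v) (μ c a) ∉ S := by
  intro t ht
  rw [Finset.mem_range] at ht
  by_cases hle : t ≤ k - i
  · have h := h₁ t (Finset.mem_range.2 (by omega))
    rw [← traj_first_half μ hl hle a, ← traj_first_half μ hl hle (μ c a)] at h
    exact h
  · have hlt : k - i < t := not_le.mp hle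
    obtain ⟨j, rfl⟩ : ∃ j, t = k - i + j := ⟨t - (k - i), by omega⟩
    have hj : j ≤ k - i := by omega
    have h := h₂ (k - i - j) (Finset.mem_range.2 (by omega))
    rw [hstr, ← traj_second_half μ hμ hl hj a, ← traj_second_half μ hμ hl hj (μ c a)] at h
    exact h

/-! ### The counted forbidden-set supply -/

/-- **Counted forbidden-set supply of same-colour reflection structures.**  For three fixed-point-free involutions, any
colour `c`, any `k` and any set `S` of vertices:
`(n·2^k - 2(k+1)·|S|·2^k)² ≤ (n² - n) · (n·2^k + Σ_{i<k} 3^i · Π^S(2k - 2i))`,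
where `Π^S(m)` is the number of same-colour reflection structures `(a, g')` of colour `c` and length `m` all of whose
trajectory points `a · g'_[t]`, `(μ c a) · g'_[t]`, `t ≤ m`, lie outside `S`.
Proof: apply `sameColourSupply_restricted` to the set of darts avoiding `S` at all times (`card_darts_avoiding_ge` bounds its
size from below) and forget the suffix after `structure_avoids_of_darts_avoid`. -/
theorem sameColourSupplyAvoiding (n k : ℕ) (μ : Fin 3 → Equiv.Perm (Fin n)) (c : Fin 3) (S : Finset (Fin n))
    (hμ : ∀ b, μ b * μ b = 1) (hfix : ∀ b v, μ b v ≠ v) :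
    (n * 2 ^ k - 2 * (k + 1) * S.card * 2 ^ k) ^ 2 ≤ (n * n - n) * (n * 2 ^ k + ∑ i ∈ Finset.range k, 3 ^ i *
      ((((Finset.univ : Finset (Fin n)) ×ˢ
        (((Finset.univ : Finset (List.Vector (Fin 3) (2 * k - 2 * i))).image (fun v => v.toList)).filter
          (fun g => List.IsChain (· ≠ ·) g ∧ g.head? ≠ some c ∧ g.getLast? ≠ some c))).filter
        (fun p => μ c (p.2.foldl (fun v b => μ b v) p.1) = p.2.foldl (fun v b => μ b v) (μ c p.1))).filter
        (fun p : Fin n × List (Fin 3) => ∀ t ∈ Finset.range (2 * k - 2 * i + 1), (p.2.take t).foldl (fun v b => μ b v) p.1 ∉ S ∧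
          (p.2.take t).foldl (fun v b => μ b v) (μ c p.1) ∉ S)).card) := by
  set D := (Finset.univ : Finset (Fin n)) ×ˢ
    (((Finset.univ : Finset (List.Vector (Fin 3) k)).image (fun v => v.toList)).filter
      (fun g => List.IsChain (· ≠ ·) g ∧ g.head? ≠ some c)) with hD
  have hDcard : D.card = n * 2 ^ k := by
    rw [hD, Finset.card_product, Finset.card_univ, Fintype.card_fin, card_redWords k c]
  set G := D.filter (fun p : Fin n × List (Fin 3) => ∀ t ∈ Finset.range (k + 1), (p.2.take t).foldl (fun v b => μ b v) p.1 ∉ S ∧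
    (p.2.take t).foldl (fun v b => μ b v) (μ c p.1) ∉ S) with hGdef
  have hGD : G ⊆ D := Finset.filter_subset _ _
  have hlow : n * 2 ^ k - 2 * (k + 1) * S.card * 2 ^ k ≤ G.card := by
    have := card_darts_avoiding_ge μ hμ c k S
    rw [← hD, ← hGdef] at this
    exact Nat.sub_le_of_le_add this
  have hGle : G.card ≤ n * 2 ^ k := by rw [← hDcard]; exact Finset.card_le_card hGD
  have hmain := sameColourSupply_restricted n k μ c hμ hfix G hGD
  refine (Nat.pow_le_pow_left hlow 2).trans (hmain.trans (Nat.mul_le_mul_left _ ?_))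
  refine Nat.add_le_add hGle (Finset.sum_le_sum (fun i hi => ?_))
  have hik : i < k := Finset.mem_range.1 hi
  rw [← card_words i, ← Finset.card_product]
  refine Finset.card_le_card ?_
  intro r hr
  rw [Finset.mem_filter, Finset.mem_product, Finset.mem_filter, Finset.mem_product, Finset.mem_filter] at hr
  obtain ⟨⟨hs, ⟨-, hl, hch, hh, hlast⟩, hstr⟩, hd₁, hd₂⟩ := hr
  rw [mem_words] at hl
  rw [hGdef, Finset.mem_filter] at hd₁ hd₂
  rw [Finset.mem_product]
  refine ⟨hs, Finset.mem_filter.2 ⟨Finset.mem_filter.2 ⟨Finset.mem_product.2 ⟨Finset.mem_univ _,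
    Finset.mem_filter.2 ⟨mem_words.2 hl, hch, hh, hlast⟩⟩, hstr⟩, ?_⟩⟩
  exact structure_avoids_of_darts_avoid μ hμ c hik S hl hstr hd₁.2 hd₂.2

/-- **Registered form** (`stub_sameColourSupplyAvoiding`, a `--supports` sub-goal of crux
`stmt-MatrixMultiplication-10883`, helper for the open core `stub_poorRigidCore`): the counted forbidden-set supply
`sameColourSupplyAvoiding`, fully quantified.  With `S := R`, `|R| ≤ n^{3/4}`, `k = ⌈log₂ n⌉ + 2` it gives `≥ n²` ordered
colliding pairs of `R`-free darts, hence (pigeonholing `i`) a scale `m ≤ 2k` carrying `≥ n² / (k · 3^{k - m/2})` same-colour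
structures every point of which avoids `R` — the counted, forbidden-set version of the supply (15.1) that the sibling helpers
`stub_sameColourNoTips` / `stub_cleanReflection` consume one clean member of. -/
theorem stub_sameColourSupplyAvoiding : ∀ (n k : ℕ) (μ : Fin 3 → Equiv.Perm (Fin n)) (c : Fin 3) (S : Finset (Fin n)), (∀ b, μ b * μ b = 1) → (∀ b v, μ b v ≠ v) → (n * 2 ^ k - 2 * (k + 1) * S.card * 2 ^ k) ^ 2 ≤ (n * n - n) * (n * 2 ^ k + ∑ i ∈ Finset.range k, 3 ^ i * ((((Finset.univ : Finset (Fin n)) ×ˢ (((Finset.univ : Finset (List.Vector (Fin 3) (2 * k - 2 * i))).image (fun v => v.toList)).filter (fun g => List.IsChain (· ≠ ·) g ∧ g.head? ≠ some c ∧ g.getLast? ≠ some c))).filter (fun p => μ c (p.2.foldl (fun v b => μ b v) p.1) = p.2.foldl (fun v b => μ b v) (μ c p.1))).filter (fun p : Fin n × List (Fin 3) => ∀ t ∈ Finset.range (2 * k - 2 * i + 1), (p.2.take t).foldl (fun v b => μ b v) p.1 ∉ S ∧ (p.2.take t).foldl (fun v b => μ b v) (μ c p.1) ∉ S)).card) 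:=
  fun n k μ c S hμ hfix => sameColourSupplyAvoiding n k μ c S hμ hfix

end Summit.MatrixMultiplication.MatrixMultiplication.Theorems.HyperoctahedralThreshold.SupplyAvoiding
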